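import Summits.CriticalPhenomena.PercolationContinuityZ3.Theorems.Transplant.CubicLatticesSkeleton
import Mathlib.Tactic.FinCases
import HarnessLib

/-!
# Planar-skeleton data (Φ1) for the fcc and bcc lattices, II: `D₄`-equivariance of the skeleton under the swap `x₀ ↔ x₁` and the flip `x₀ ↦ −x₀`

builds on p205010 (kernel theorem, internal audit signed; external expert review pending).
Status sentence (coordinator 2026-08-20T04:30Z): "θ(p_c) = 0 on ℤ^d, all d ≥ 2 — kernel-verified (Lean 4/Mathlib,
standard axioms); internal adversarial audit SIGNED 2026-08-20 04:29Z; external expert review pending."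

New lemmas of the lane (`prim-bschramm-*`, seat `prim-bschramm-stmt`; `BLUEPRINT-I-PHI.md` §0: the automorphism subgroup must realise the dihedral group
`D₄ = HOct 2` of the skeleton lattice `ℤ²`, `φ`-equivariantly; pattern of p4's `heisSwapIso` / `heisFlipIso`).  Two elements of the cubic point group
(`fccPointIso` / `bccPointIso` of `CubicLatticesSkeleton.lean`) stabilising the fibre axis `x₂`: the swap `σ : x₀ ↔ x₁` and the flip `τ : x₀ ↦ −x₀`
(`flipSigns`), as automorphisms `fccSwapIso`, `fccFlipIso`, `bccSwapIso`, `bccFlipIso` fixing the origins (`cubic_swap_flip_origin`) and the fibre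
coordinate (`fcc_swap_flip_fibre`, `bcc_swap_flip_fibre`), with the equivariance formulas
`fccSkel (σ x) = (x₁, x₀)`, `fccSkel (τ x) = (−x₀, x₁)` (diagonal and axial reflections of `ℤ²`) and, in the rotated bcc frame
`φ = ((x₀+x₁)/2, (x₀−x₁)/2)`, `bccSkel (σ x) = (φ₀, −φ₁)`, `bccSkel (τ x) = (−φ₁, −φ₀)` (axial and anti-diagonal reflections); in both cases the two
reflections generate `D₄` (their product is a quarter turn) — the point symmetry of Kozma–Nitzan's Lemma 8 in two dimensions.
[cite: ConwaySloane1999, Ch. 4 §7.1 (automorphisms of D_n: permutations and sign changes)] [cite: KozmaNitzan2024, §4 Lemma 8 (p. 16)]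
-/

noncomputable section

namespace Summit.CriticalPhenomena.PercolationContinuityZ3.Theorems.Transplant

open Literature.Probability.Percolation Literature.Probability.LatticeModels

/-! ## `D₄`-equivariance: the swap `x₀ ↔ x₁` and the flip `x₀ ↦ −x₀` -/

/-- The signs `(−1, 1, 1)`: flip the first coordinate. [folklore] -/
def flipSigns : Fin 3 → ℤˣ := fun i => if i = 0 then -1 else 1

/-- The swap `(x₀, x₁, x₂) ↦ (x₁, x₀, x₂)` in coordinates. [folklore] -/
theorem signedPerm_swap_apply (x : Site 3) :
    Site.signedPerm (Equiv.swap 0 1) (fun _ => 1) x = ![x 1, x 0, x 2] := by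
  ext i
  fin_cases i <;> simp [Site.signedPerm_apply, Equiv.swap_apply_of_ne_of_ne]

/-- The flip `(x₀, x₁, x₂) ↦ (−x₀, x₁, x₂)` in coordinates. [folklore] -/
theorem signedPerm_flip_apply (x : Site 3) :
    Site.signedPerm (Equiv.refl (Fin 3)) flipSigns x = ![-x 0, x 1, x 2] := by
  ext i
  fin_cases i <;> simp [Site.signedPerm_apply, flipSigns]

/-- The swap `x₀ ↔ x₁` as an automorphism of the fcc lattice fixing the origin. [cite: ConwaySloane1999, Ch. 4 §7.1] -/
def fccSwapIso : fccGraph ≃g fccGraph := fccPointIso (Equiv.swap 0 1) (fun _ => 1)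
/-- The flip `x₀ ↦ −x₀` as an automorphism of the fcc lattice fixing the origin. [cite: ConwaySloane1999, Ch. 4 §7.1] -/
def fccFlipIso : fccGraph ≃g fccGraph := fccPointIso (Equiv.refl (Fin 3)) flipSigns
/-- The swap `x₀ ↔ x₁` as an automorphism of the bcc lattice fixing the origin. [cite: ConwaySloane1999, Ch. 4 §7.1] -/
def bccSwapIso : bccGraph ≃g bccGraph := bccPointIso (Equiv.swap 0 1) (fun _ => 1)
/-- The flip `x₀ ↦ −x₀` as an automorphism of the bcc lattice fixing the origin. [cite: ConwaySloane1999, Ch. 4 §7.1] -/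
def bccFlipIso : bccGraph ≃g bccGraph := bccPointIso (Equiv.refl (Fin 3)) flipSigns

/-- **fcc swap-equivariance**: `φ(σ x) = (x₁, x₀)` — the diagonal reflection of `ℤ²`. [cite: KozmaNitzan2024, §4 Lemma 8 (p. 16)] -/
theorem fccSkel_swap (x : fccSite) : fccSkel (fccSwapIso x) = ![fccSkel x 1, fccSkel x 0] := by
  have h : ((fccSwapIso x : fccSite) : Site 3) = ![(x : Site 3) 1, (x : Site 3) 0, (x : Site 3) 2] := by
    rw [fccSwapIso, coe_fccPointIso, signedPerm_swap_apply]
  ext i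
  fin_cases i
  · show ((fccSwapIso x : fccSite) : Site 3) 0 = (x : Site 3) 1
    rw [h]; rfl
  · show ((fccSwapIso x : fccSite) : Site 3) 1 = (x : Site 3) 0
    rw [h]; rfl

/-- **fcc flip-equivariance**: `φ(τ x) = (−x₀, x₁)` — the reflection of `ℤ²` in the second axis; with the swap it generates `D₄`.
[cite: KozmaNitzan2024, §4 Lemma 8 (p. 16)] -/
theorem fccSkel_flip (x : fccSite) : fccSkel (fccFlipIso x) = ![-fccSkel x 0, fccSkel x 1] := by
  have h : ((fccFlipIso x : fccSite) : Site 3) = ![-(x : Site 3) 0, (x : Site 3) 1, (x : Site 3) 2] := by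
    rw [fccFlipIso, coe_fccPointIso, signedPerm_flip_apply]
  ext i
  fin_cases i
  · show ((fccFlipIso x : fccSite) : Site 3) 0 = -(x : Site 3) 0
    rw [h]; rfl
  · show ((fccFlipIso x : fccSite) : Site 3) 1 = (x : Site 3) 1
    rw [h]; rfl

/-- Both fcc symmetries fix the fibre coordinate `x₂`. [folklore] -/
theorem fcc_swap_flip_fibre (x : fccSite) :
    ((fccSwapIso x : fccSite) : Site 3) 2 = (x : Site 3) 2 ∧ ((fccFlipIso x : fccSite) : Site 3) 2 = (x : Site 3) 2 := by
  constructor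
  · rw [fccSwapIso, coe_fccPointIso, signedPerm_swap_apply]; rfl
  · rw [fccFlipIso, coe_fccPointIso, signedPerm_flip_apply]; rfl

/-- **bcc swap-equivariance**: `φ(σ x) = (φ₀ x, −φ₁ x)` — the reflection of `ℤ²` in the first axis. [cite: KozmaNitzan2024, §4 Lemma 8 (p. 16)] -/
theorem bccSkel_swap (x : bccSite) : bccSkel (bccSwapIso x) = ![bccSkel x 0, -bccSkel x 1] := by
  have h : ((bccSwapIso x : bccSite) : Site 3) = ![(x : Site 3) 1, (x : Site 3) 0, (x : Site 3) 2] := by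
    rw [bccSwapIso, coe_bccPointIso, signedPerm_swap_apply]
  have hs0 := two_mul_bccSkel_zero (bccSwapIso x)
  have hs1 := two_mul_bccSkel_one (bccSwapIso x)
  have hx0 := two_mul_bccSkel_zero x
  have hx1 := two_mul_bccSkel_one x
  rw [h] at hs0 hs1
  simp only [Matrix.cons_val_zero, Matrix.cons_val_one] at hs0 hs1
  ext i
  fin_cases i
  · change bccSkel (bccSwapIso x) 0 = bccSkel x 0; omega
  · change bccSkel (bccSwapIso x) 1 = -bccSkel x 1; omega

/-- **bcc flip-equivariance**: `φ(τ x) = (−φ₁ x, −φ₀ x)` — the reflection of `ℤ²` in the anti-diagonal; with the swap it generates `D₄`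
(their product is the quarter turn `(u, v) ↦ (v, −u)`). [cite: KozmaNitzan2024, §4 Lemma 8 (p. 16)] -/
theorem bccSkel_flip (x : bccSite) : bccSkel (bccFlipIso x) = ![-bccSkel x 1, -bccSkel x 0] := by
  have h : ((bccFlipIso x : bccSite) : Site 3) = ![-(x : Site 3) 0, (x : Site 3) 1, (x : Site 3) 2] := by
    rw [bccFlipIso, coe_bccPointIso, signedPerm_flip_apply]
  have hs0 := two_mul_bccSkel_zero (bccFlipIso x)
  have hs1 := two_mul_bccSkel_one (bccFlipIso x)
  have hx0 := two_mul_bccSkel_zero x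
  have hx1 := two_mul_bccSkel_one x
  rw [h] at hs0 hs1
  simp only [Matrix.cons_val_zero, Matrix.cons_val_one] at hs0 hs1
  ext i
  fin_cases i
  · change bccSkel (bccFlipIso x) 0 = -bccSkel x 1; omega
  · change bccSkel (bccFlipIso x) 1 = -bccSkel x 0; omega

/-- Both bcc symmetries fix the fibre coordinate `x₂`. [folklore] -/
theorem bcc_swap_flip_fibre (x : bccSite) :
    ((bccSwapIso x : bccSite) : Site 3) 2 = (x : Site 3) 2 ∧ ((bccFlipIso x : bccSite) : Site 3) 2 = (x : Site 3) 2 := by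
  constructor
  · rw [bccSwapIso, coe_bccPointIso, signedPerm_swap_apply]; rfl
  · rw [bccFlipIso, coe_bccPointIso, signedPerm_flip_apply]; rfl

/-- All four generating symmetries fix the respective origins. [folklore] -/
theorem cubic_swap_flip_origin :
    fccSwapIso fccOrigin = fccOrigin ∧ fccFlipIso fccOrigin = fccOrigin ∧ bccSwapIso bccOrigin = bccOrigin ∧ bccFlipIso bccOrigin = bccOrigin :=
  ⟨fccPointIso_origin _ _, fccPointIso_origin _ _, bccPointIso_origin _ _, bccPointIso_origin _ _⟩

end Summit.CriticalPhenomena.PercolationContinuityZ3.Theorems.Transplant
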